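import Literature.Analysis.FluidPDE.ScalarFourierData
import Literature.Analysis.FluidPDE.ScalarFourierTimeRegularity
import Literature.Analysis.FluidPDE.PassiveScalarWellPosedness
import Literature.Analysis.FluidPDE.PassiveScalarClassicalWeak
import Literature.Analysis.FluidPDE.PassiveScalarEnergyPointwise
import Literature.Analysis.FluidPDE.ScalarEnergyCalculus
import Literature.Analysis.FunctionSpaces.TorusSobolevNormProofs
import HarnessLib

/-!
# Discharge of `Torus.exists_unique_isClassicalScalarTransportForcedOn`

Analysis/FluidPDE proof file, last of the files discharging the named fact
`Literature.Analysis.FluidPDE.Torus.exists_unique_isClassicalScalarTransportForcedOn` of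
`PassiveScalarWellPosedness` (classical well-posedness of the forced advection–diffusion
equation `∂ₜθ + u·∇θ = κΔθ + s`, `θ(0) = θ₀`, on `[0, T] × T^d` for `κ > 0` and smooth data;
Krylov 1996, Thm. 9.2.3 for the Cauchy problem in parabolic Hölder spaces, of which this is the
smooth periodic case used by Cheskidov 2023, §4 (4.2)). The statement was found faithful as
vendored.

* **Existence** (`Torus.exists_isClassicalScalarTransportForcedOn`). Complexify the data,
  pass to Fourier coefficients (`ScalarFourier.coeffFamily`, `ScalarFourierData`), solve the
  transformed mild system by Picard iteration (`ScalarFourierPicard`), bootstrap all time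
  derivatives (`ScalarFourierTimeRegularity`), synthesize `Θ(t,x) = ∑ₖ c(t,k) e_k(x)`, jointly
  smooth on `[0,T] × T^d` (`ScalarFourierSynthesis`), and put `θ = Re Θ`. The equation holds
  because the continuous defect `∂ₜΘ + ∑ⱼ uⱼ∂ⱼΘ - κΔΘ - s` has all Fourier coefficients zero
  (the differentiated mild equation `∂ₜc = -νₖc + ŝ - N(û, c)`, products ↦ lattice convolutions,
  `∂ⱼ ↦ 2πi kⱼ`, `Δ ↦ -4π²|k|²`), hence vanishes (uniqueness of Fourier coefficients, tree
  `Torus.ae_eq_zero_of_forall_mFourierCoeff_eq_zero`, Grafakos 2014, Prop. 3.2.4, and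
  continuity); real parts commute with `∂ₜ`, `∂ⱼ`, `Δ`. The datum is Fourier inversion.
* **Uniqueness** (`Torus.IsClassicalScalarTransportForcedOn.eq_on_Icc`). The difference of two
  solutions is a classical solution of the homogeneous equation with datum `0`, hence a weak
  solution (discharged fact `Torus.IsClassicalScalarTransportOn.isWeakScalarTransportOn`), so
  the energy inequality (discharged fact `Torus.IsWeakScalarTransportOn.lintegral_sq_add_le`,
  DEIJ 2022, (1.3)) forces `‖δ(t)‖_{L²} = 0` for a.e. `t`, and continuity gives `δ = 0` on
  `[0, T]` (tree `Literature.Analysis.FluidPDE.eq_zero_of_continuousOn_Ioc_of_ae_eq_zero`).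

The proof is not Krylov's (a priori Schauder estimates and the method of continuity); it is the
classical Fourier method for smooth periodic data (cf. Evans, *PDE*, §7.1.2–7.1.3 for the
Galerkin/Fourier construction of parabolic solutions and their regularity).

## References

* N. V. Krylov, *Lectures on Elliptic and Parabolic Equations in Hölder Spaces*, GSM 12, AMS
  1996, Thm. 9.2.3 (PDF p. 151), Thm. 8.12.1, Ex. 8.12.4. [Krylov1996]
* A. Cheskidov, arXiv:2311.04182 (2023), §4, (4.2). [Cheskidov2023]
* L. Grafakos, *Classical Fourier Analysis*, 3rd ed. (2014), Prop. 3.2.4, Prop. 3.2.6 (8),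
  §3.3.1. [Grafakos2014]
* T. Drivas, T. Elgindi, G. Iyer, I.-J. Jeong, Arch. Ration. Mech. Anal. 243 (2022), (1.3).
  [DEIJ2022]
* L. C. Evans, *Partial Differential Equations*, 2nd ed. (2010), §7.1.2–7.1.3.
-/

noncomputable section

namespace Literature.Analysis.FluidPDE

namespace Torus

open MeasureTheory Real Set Filter UnitAddTorus Complex
open scoped Topology ContDiff InnerProductSpace ENNReal
open FourierNS (HasDecay clamp)
open ScalarFourier
open Literature.Analysis.FunctionSpaces.Torus (proj stLift timeDerivWithin IsSmoothSpaceTimeOn IsSmooth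
  laplacian partialDeriv gradient freqNormSq)

variable {d : Type*} [Fintype d] [DecidableEq d]

/-! ### Real parts of derivatives of complex-valued smooth functions on the torus -/

section RealPart

omit [DecidableEq d] in
/-- The real part of a smooth complex function on `T^d` is smooth. [folklore] -/
theorem IsSmooth.re {g : UnitAddTorus d → ℂ} (hg : IsSmooth g) : IsSmooth (fun y => (g y).re) :=
  hg.comp_clm Complex.reCLM

/-- Partial derivatives commute with the real part: `∂ⱼ (Re g) = Re (∂ⱼ g)` for smooth `g`. [folklore] -/
theorem partialDeriv_re {g : UnitAddTorus d → ℂ} (hg : IsSmooth g) (j : d) (x : UnitAddTorus d) :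
    partialDeriv j (fun y => (g y).re) x = (partialDeriv j g x).re := by
  have h := hg.hasDerivAt_line_zero j x
  have h2 : HasDerivAt (fun t : ℝ => (g (x + proj (t • EuclideanSpace.single j (1 : ℝ)))).re)
      (partialDeriv j g x).re 0 := by
    have := Complex.reCLM.hasFDerivAt.comp_hasDerivAt (0 : ℝ) h
    exact this
  exact h2.deriv

/-- The Laplacian commutes with the real part: `Δ (Re g) = Re (Δ g)` for smooth `g`. [folklore] -/
theorem laplacian_re {g : UnitAddTorus d → ℂ} (hg : IsSmooth g) (x : UnitAddTorus d) :
    laplacian (fun y => (g y).re) x = (laplacian g x).re := by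
  rw [FunctionSpaces.Torus.laplacian_eq_sum_partialDeriv_partialDeriv (IsSmooth.re hg),
    FunctionSpaces.Torus.laplacian_eq_sum_partialDeriv_partialDeriv hg, Complex.re_sum]
  refine Finset.sum_congr rfl fun i _ => ?_
  have h1 : partialDeriv i (fun y => (g y).re) = fun y => (partialDeriv i g y).re :=
    funext fun y => partialDeriv_re hg i y
  rw [h1, partialDeriv_re (hg.partialDeriv i)]

omit [DecidableEq d] in
/-- The one-sided time derivative commutes with the real part for jointly smooth fields. [folklore] -/
theorem timeDerivWithin_re {S : Set ℝ} {Θ : ℝ → UnitAddTorus d → ℂ} (hΘ : IsSmoothSpaceTimeOn S Θ)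
    (hS : UniqueDiffOn ℝ S) {t : ℝ} (ht : t ∈ S) (x : UnitAddTorus d) :
    timeDerivWithin S (fun s y => (Θ s y).re) t x = (timeDerivWithin S Θ t x).re := by
  have h := hΘ.hasDerivWithinAt_slice ht x
  have h2 : HasDerivWithinAt (fun s => (Θ s x).re) (timeDerivWithin S Θ t x).re S t := by
    have := Complex.reCLM.hasFDerivAt.comp_hasDerivWithinAt t h
    exact this
  exact h2.derivWithin (hS t ht)

omit [DecidableEq d] in
/-- Fourier coefficients of a constant multiple (continuous integrand). [folklore] -/
theorem mFourierCoeff_const_mul' {f : UnitAddTorus d → ℂ} (c : ℂ) (k : d → ℤ) :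
    mFourierCoeff (fun x => c * f x) k = c * mFourierCoeff f k := by
  simp only [FunctionSpaces.Torus.mFourierCoeff_eq_integral_volume, smul_eq_mul, ← integral_const_mul]
  congr 1 with x
  ring

end RealPart

/-! ### Existence: the synthesized Picard limit is a classical solution -/

section Existence

variable {κ T : ℝ} {u : ℝ → UnitAddTorus d → EuclideanSpace ℝ d} {s : ℝ → UnitAddTorus d → ℝ}
  {θ₀ : UnitAddTorus d → ℝ}

-- one long verification; the coefficient bookkeeping elaborates slowly
set_option maxHeartbeats 1600000 in
/-- **Existence of a classical solution of the forced advection–diffusion equation on `T^d`.**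
For `κ > 0`, `T > 0`, a jointly smooth drift `u` (divergence free) and source `s` on
`[0, T] × T^d` and a smooth datum `θ₀`, the real part `θ = Re Θ` of the synthesized Picard
limit `Θ(t, x) = ∑ₖ c(t, k) e_k(x)` (`ScalarFourier.picardLim` of the Fourier-side data,
`ScalarFourier.torusSynth`) is a classical solution of `∂ₜθ + u·∇θ = κΔθ + s` on `[0, T]`
with `θ(0) = θ₀`: joint smoothness by `ScalarFourier.isSmoothSpaceTimeOn_torusSynth`, the
equation by comparing the Fourier coefficients of the continuous defect
`∂ₜΘ + ∑ⱼ uⱼ∂ⱼΘ - κΔΘ - s` (all zero by the differentiated mild equation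
`∂ₜc = -νₖc + ŝ - N(û, c)`; uniqueness of Fourier coefficients, Grafakos 2014, Prop. 3.2.4)
and taking real parts; the datum by Fourier inversion. This is the smooth-periodic case of
the Cauchy problem of Krylov 1996, Thm. 9.2.3 with the regularity of Thm. 8.12.1 /
Ex. 8.12.4, proved here by the Fourier method instead of Schauder estimates. [cite: Krylov1996, Thm. 9.2.3] -/
theorem exists_isClassicalScalarTransportForcedOn (hκ : 0 < κ) (hT : 0 < T)
    (hu : IsSmoothSpaceTimeOn (Icc 0 T) u) (hdiv : ∀ t ∈ Icc 0 T, FunctionSpaces.Torus.IsDivFree (u t))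
    (hs : IsSmoothSpaceTimeOn (Icc 0 T) s) (hθ₀ : IsSmooth θ₀) :
    ∃ θ : ℝ → UnitAddTorus d → ℝ,
      IsClassicalScalarTransportForcedOn (Icc 0 T) κ u s θ ∧ θ 0 = θ₀ := by
  have hS : UniqueDiffOn ℝ (Icc 0 T) := uniqueDiffOn_Icc hT
  -- complexified data
  set ψ : d → ℝ → UnitAddTorus d → ℂ := fun j t x => ((u t x j : ℝ) : ℂ) with hψdef
  set σ : ℝ → UnitAddTorus d → ℂ := fun t x => ((s t x : ℝ) : ℂ) with hσdef
  set g : UnitAddTorus d → ℂ := fun x => ((θ₀ x : ℝ) : ℂ) with hgdef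
  have hψs : ∀ j, IsSmoothSpaceTimeOn (Icc 0 T) (ψ j) := fun j =>
    (hu.apply j).clm_comp Complex.ofRealCLM
  have hσs : IsSmoothSpaceTimeOn (Icc 0 T) σ := hs.clm_comp Complex.ofRealCLM
  have hgs : IsSmooth g := hθ₀.comp_clm Complex.ofRealCLM
  -- Fourier-side data
  set UF : d → ℕ → ℝ → (d → ℤ) → ℂ := fun j => coeffFamily (Icc 0 T) (ψ j) with hUFdef
  set SF : ℕ → ℝ → (d → ℤ) → ℂ := coeffFamily (Icc 0 T) σ with hSFdef
  set a : (d → ℤ) → ℂ := fun k => mFourierCoeff g k with hadef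
  set U : d → ℝ → (d → ℤ) → ℂ := fun j t => UF j 0 (clamp T t) with hUdef
  set S' : ℝ → (d → ℤ) → ℂ := fun t => SF 0 (clamp T t) with hS'def
  have hUFf : ∀ n j, IsCoeffFamily T n (UF j) := fun n j => isCoeffFamily_coeffFamily hT (hψs j) n
  have hSFf : ∀ n, IsCoeffFamily T n SF := fun n => isCoeffFamily_coeffFamily hT hσs n
  have hP : PicardHyp κ T U S' a := by
    refine ⟨hκ, hT, fun j m => ?_, fun K => ?_, fun m => ?_, fun K => ?_, fun K => ?_⟩
    · exact ((hUFf 0 j).cont 0 le_rfl m).comp_continuous (FourierNS.continuous_clamp T)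
        fun t => FourierNS.clamp_mem_Icc hT.le t
    · have h1 : ∀ j, ∃ C : ℝ, 0 ≤ C ∧ ∀ t ∈ Icc 0 T, HasDecay K C (UF j 0 t) := fun j =>
        (hUFf 0 j).decay_nonneg le_rfl K
      choose C hC0 hC using h1
      refine ⟨∑ j, C j, fun j t => ((hC j _ (FourierNS.clamp_mem_Icc hT.le t)).mono ?_)⟩
      exact Finset.single_le_sum (fun i _ => hC0 i) (Finset.mem_univ j)
    · exact ((hSFf 0).cont 0 le_rfl m).comp_continuous (FourierNS.continuous_clamp T)
        fun t => FourierNS.clamp_mem_Icc hT.le t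
    · obtain ⟨C, -, hC⟩ := (hSFf 0).decay_nonneg le_rfl K
      exact ⟨C, fun t => hC _ (FourierNS.clamp_mem_Icc hT.le t)⟩
    · obtain ⟨C, -, hC⟩ := exists_hasDecay_mFourierCoeff hgs K
      exact ⟨C, hC⟩
  set c := picardLim κ T U S' a with hcdef
  have hU0 : ∀ j, ∀ t ∈ Icc 0 T, UF j 0 t = U j t := fun j t ht => by
    simp only [hUdef, FourierNS.clamp_of_mem ht]
  have hS0 : ∀ t ∈ Icc 0 T, SF 0 t = S' t := fun t ht => by
    simp only [hS'def, FourierNS.clamp_of_mem ht]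
  have hfam : ∀ n, ∃ W : ℕ → ℝ → (d → ℤ) → ℂ, W 0 = c ∧ IsCoeffFamily T n W := fun n =>
    hP.exists_coeffFamily hUFf hSFf hU0 hS0 n
  -- the synthesized solution and its real part
  set Θ : ℝ → UnitAddTorus d → ℂ := torusSynth c with hΘdef
  have hΘs : IsSmoothSpaceTimeOn (Icc 0 T) Θ := isSmoothSpaceTimeOn_torusSynth hT hfam
  set θ : ℝ → UnitAddTorus d → ℝ := fun t x => (Θ t x).re with hθdef
  have hθs : IsSmoothSpaceTimeOn (Icc 0 T) θ := hΘs.clm_comp Complex.reCLM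
  obtain ⟨Cc, -, hCc⟩ := hP.hasDecay_picardLim (latOrder d)
  -- the complex equation
  have hcomplex : ∀ t ∈ Icc 0 T, ∀ x, timeDerivWithin (Icc 0 T) Θ t x +
      ∑ j, ψ j t x * partialDeriv j (Θ t) x = (κ : ℂ) * laplacian (Θ t) x + σ t x := by
    intro t ht
    obtain ⟨W, hW0, hW⟩ := hfam 1
    -- `W₁(t) = -ν c(t) + S(t) - N(U(t), c(t))`
    have hW1 : ∀ k, W 1 t k =
        -(heatRate κ k : ℂ) * c t k + (S' t k - transportSym (fun j => U j t) (c t) k) := fun k => by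
      have h1 := hW.deriv 0 (by norm_num) k t ht
      rw [hW0] at h1
      have h2 := hP.hasDerivWithinAt_picardLim k ht
      exact (h1.derivWithin (hS t ht)).symm.trans (h2.derivWithin (hS t ht))
    -- time derivative of `Θ`
    have hdt : ∀ x, timeDerivWithin (Icc 0 T) Θ t x = torusSynth (W 1) t x := fun x => by
      have := timeDerivWithin_torusSynth hT hW ht x
      rwa [hW0] at this
    -- the Fourier coefficients of all terms
    have hsumc : Summable fun k => ‖c t k‖ := summable_norm_of_hasDecay le_rfl (hCc t)
    have hcΘ : ∀ k, mFourierCoeff (Θ t) k = c t k := fun k => mFourierCoeff_tsum_mul_mFourier hsumc k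
    obtain ⟨C1, -, hC1⟩ := hW.decay_nonneg le_rfl (latOrder d)
    have hsum1 : Summable fun k => ‖W 1 t k‖ := summable_norm_of_hasDecay le_rfl (hC1 t ht)
    have hcdt : ∀ k, mFourierCoeff (timeDerivWithin (Icc 0 T) Θ t) k = W 1 t k := fun k => by
      have : timeDerivWithin (Icc 0 T) Θ t = fun x => ∑' m, W 1 t m * mFourier m x := funext hdt
      rw [this]
      exact mFourierCoeff_tsum_mul_mFourier hsum1 k
    have hΘt : IsSmooth (Θ t) := hΘs.isSmooth_slice ht
    have hcD : ∀ j k, mFourierCoeff (partialDeriv j (Θ t)) k = dsym j k * c t k := fun j k => by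
      rw [FunctionSpaces.Torus.mFourierCoeff_partialDeriv hΘt j k, hcΘ, dsym_apply, smul_eq_mul]
    have hcΔ : ∀ k, mFourierCoeff (laplacian (Θ t)) k =
        -((4 * π ^ 2 * freqNormSq k : ℝ) : ℂ) * c t k := fun k => by
      rw [mFourierCoeff_laplacian hΘt, hcΘ]
    have hcP : ∀ j k, mFourierCoeff (fun x => ψ j t x * partialDeriv j (Θ t) x) k =
        lconv (UF j 0 t) (fun m => dsym j m * c t m) k := fun j k => by
      have hψt : IsSmooth (ψ j t) := (hψs j).isSmooth_slice ht
      rw [mFourierCoeff_mul hψt.continuous (summable_norm_mFourierCoeff hψt)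
        (hΘt.partialDeriv j).continuous]
      have h2 : (fun m => mFourierCoeff (partialDeriv j (Θ t)) m) = fun m => dsym j m * c t m :=
        funext fun m => hcD j m
      rw [h2]
      rfl
    -- the defect and its coefficients
    set E : UnitAddTorus d → ℂ := fun x => timeDerivWithin (Icc 0 T) Θ t x +
      ∑ j, ψ j t x * partialDeriv j (Θ t) x - (κ : ℂ) * laplacian (Θ t) x - σ t x with hEdef
    have hAt : IsSmooth (timeDerivWithin (Icc 0 T) Θ t) := (hΘs.timeDerivWithin hS).isSmooth_slice ht
    have hBc : Continuous fun x => ∑ j, ψ j t x * partialDeriv j (Θ t) x :=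
      continuous_finsetSum _ fun j _ =>
        ((hψs j).isSmooth_slice ht).continuous.mul (hΘt.partialDeriv j).continuous
    have hCc' : Continuous fun x => (κ : ℂ) * laplacian (Θ t) x :=
      continuous_const.mul hΘt.laplacian.continuous
    have hDc : Continuous (σ t) := (hσs.isSmooth_slice ht).continuous
    have hEc : Continuous E := ((hAt.continuous.add hBc).sub hCc').sub hDc
    have hEcoeff : ∀ k, mFourierCoeff E k = 0 := by
      intro k
      have hAi := hAt.continuous.integrable_unitAddTorus
      have hBi := hBc.integrable_unitAddTorus
      have hCi := hCc'.integrable_unitAddTorus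
      have hDi := hDc.integrable_unitAddTorus
      change mFourierCoeff (((timeDerivWithin (Icc 0 T) Θ t + fun x => ∑ j, ψ j t x * partialDeriv j (Θ t) x) -
        fun x => (κ : ℂ) * laplacian (Θ t) x) - σ t) k = 0
      rw [FunctionSpaces.Torus.mFourierCoeff_sub ((hAi.add hBi).sub hCi) hDi,
        FunctionSpaces.Torus.mFourierCoeff_sub (hAi.add hBi) hCi,
        FunctionSpaces.Torus.mFourierCoeff_add hAi hBi,
        FunctionSpaces.Torus.mFourierCoeff_finset_sum (f := fun j x => ψ j t x * partialDeriv j (Θ t) x) _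
          (fun j _ => (((hψs j).isSmooth_slice ht).continuous.mul
            (hΘt.partialDeriv j).continuous).integrable_unitAddTorus),
        mFourierCoeff_const_mul', hcdt, hcΔ, hW1 k]
      simp_rw [hcP]
      have hσc : mFourierCoeff (σ t) k = S' t k := by rw [← hS0 t ht]; rfl
      rw [hσc, transportSym_apply]
      simp_rw [← hU0 _ t ht]
      rw [heatRate_apply]
      push_cast
      ring
    -- hence `E = 0`
    have hae := FunctionSpaces.Torus.ae_eq_zero_of_forall_mFourierCoeff_eq_zero
      hEc.integrable_unitAddTorus hEcoeff
    have hE0 : E = 0 := (hEc.ae_eq_iff_eq volume continuous_const).1 hae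
    intro x
    have hx := congrFun hE0 x
    simp only [hEdef, Pi.zero_apply] at hx
    linear_combination hx
  refine ⟨θ, ⟨hu, hs, hθs, fun t ht x => ?_, hdiv⟩, ?_⟩
  · -- the real equation
    have hΘt : IsSmooth (Θ t) := hΘs.isSmooth_slice ht
    have hθt : IsSmooth (θ t) := IsSmooth.re hΘt
    have h := congrArg Complex.re (hcomplex t ht x)
    simp only [Complex.add_re, Complex.re_sum, hψdef, hσdef, Complex.re_ofReal_mul,
      Complex.ofReal_re] at h
    rw [timeDerivWithin_re hΘs hS ht,
      FunctionSpaces.Torus.inner_gradient_eq_sum_mul_partialDeriv (hθt.isContDiff (by simp)),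
      laplacian_re hΘt]
    simp_rw [show ∀ j, partialDeriv j (θ t) x = (partialDeriv j (Θ t) x).re from
      fun j => partialDeriv_re hΘt j x]
    exact h
  · -- the datum
    funext x
    have hc0 : c 0 = a := funext fun k => hP.picardLim_zero k
    have h1 : Θ 0 x = g x := by
      change (∑' k, c 0 k * mFourier k x) = g x
      rw [hc0]
      exact tsum_mFourierCoeff_mul_mFourier hgs.continuous (summable_norm_mFourierCoeff hgs) x
    change (Θ 0 x).re = θ₀ x
    rw [h1, hgdef, Complex.ofReal_re]

end Existence

/-! ### Uniqueness: the energy inequality for the difference -/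

section Uniqueness

variable {κ T : ℝ} {u : ℝ → UnitAddTorus d → EuclideanSpace ℝ d} {s : ℝ → UnitAddTorus d → ℝ}
  {θ₁ θ₂ : ℝ → UnitAddTorus d → ℝ}

/-- Partial derivatives of a difference of smooth functions. [folklore] -/
theorem partialDeriv_sub' {F : Type*} [NormedAddCommGroup F] [NormedSpace ℝ F]
    {f g : UnitAddTorus d → F} (hf : IsSmooth f) (hg : IsSmooth g) (j : d) (x : UnitAddTorus d) :
    partialDeriv j (fun y => f y - g y) x = partialDeriv j f x - partialDeriv j g x :=
  ((hf.hasDerivAt_line_zero j x).sub (hg.hasDerivAt_line_zero j x)).deriv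

/-- Laplacians of a difference of smooth functions. [folklore] -/
theorem laplacian_sub' {F : Type*} [NormedAddCommGroup F] [NormedSpace ℝ F]
    {f g : UnitAddTorus d → F} (hf : IsSmooth f) (hg : IsSmooth g) (x : UnitAddTorus d) :
    laplacian (fun y => f y - g y) x = laplacian f x - laplacian g x := by
  have hfg : IsSmooth (fun y => f y - g y) := hf.sub hg
  rw [FunctionSpaces.Torus.laplacian_eq_sum_partialDeriv_partialDeriv hfg,
    FunctionSpaces.Torus.laplacian_eq_sum_partialDeriv_partialDeriv hf,
    FunctionSpaces.Torus.laplacian_eq_sum_partialDeriv_partialDeriv hg, ← Finset.sum_sub_distrib]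
  refine Finset.sum_congr rfl fun i _ => ?_
  have h1 : partialDeriv i (fun y => f y - g y) = fun y => partialDeriv i f y - partialDeriv i g y :=
    funext fun y => partialDeriv_sub' hf hg i y
  change partialDeriv i (partialDeriv i (fun y => f y - g y)) x = _
  rw [h1, partialDeriv_sub' (hf.partialDeriv i) (hg.partialDeriv i)]

/-- **The difference of two classical forced solutions is a classical solution of the
homogeneous equation** (linearity). [folklore] -/
theorem IsClassicalScalarTransportForcedOn.sub (hT : 0 < T)
    (h₁ : IsClassicalScalarTransportForcedOn (Icc 0 T) κ u s θ₁)
    (h₂ : IsClassicalScalarTransportForcedOn (Icc 0 T) κ u s θ₂) :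
    IsClassicalScalarTransportOn (Icc 0 T) κ u (fun t x => θ₁ t x - θ₂ t x) := by
  have hS : UniqueDiffOn ℝ (Icc 0 T) := uniqueDiffOn_Icc hT
  refine ⟨h₁.smooth_velocity, h₁.smooth_scalar.sub h₂.smooth_scalar, fun t ht x => ?_, h₁.divFree⟩
  have h1t : IsSmooth (θ₁ t) := h₁.smooth_scalar.isSmooth_slice ht
  have h2t : IsSmooth (θ₂ t) := h₂.smooth_scalar.isSmooth_slice ht
  have hdt : timeDerivWithin (Icc 0 T) (fun t x => θ₁ t x - θ₂ t x) t x =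
      timeDerivWithin (Icc 0 T) θ₁ t x - timeDerivWithin (Icc 0 T) θ₂ t x :=
    ((h₁.smooth_scalar.hasDerivWithinAt_slice ht x).sub
      (h₂.smooth_scalar.hasDerivWithinAt_slice ht x)).derivWithin (hS t ht)
  have h12 : IsSmooth (fun y => θ₁ t y - θ₂ t y) := h1t.sub h2t
  have hgrad : ⟪u t x, gradient (fun y => θ₁ t y - θ₂ t y) x⟫_ℝ =
      ⟪u t x, gradient (θ₁ t) x⟫_ℝ - ⟪u t x, gradient (θ₂ t) x⟫_ℝ := by
    rw [FunctionSpaces.Torus.inner_gradient_eq_sum_mul_partialDeriv (h12.isContDiff (by simp)),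
      FunctionSpaces.Torus.inner_gradient_eq_sum_mul_partialDeriv (h1t.isContDiff (by simp)),
      FunctionSpaces.Torus.inner_gradient_eq_sum_mul_partialDeriv (h2t.isContDiff (by simp)),
      ← Finset.sum_sub_distrib]
    refine Finset.sum_congr rfl fun j _ => ?_
    change u t x j * partialDeriv j (fun y => θ₁ t y - θ₂ t y) x = _
    rw [partialDeriv_sub' h1t h2t, mul_sub]
  have hlap : laplacian (fun y => θ₁ t y - θ₂ t y) x = laplacian (θ₁ t) x - laplacian (θ₂ t) x :=
    laplacian_sub' h1t h2t x
  have e1 := h₁.transport t ht x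
  have e2 := h₂.transport t ht x
  change timeDerivWithin (Icc 0 T) (fun t x => θ₁ t x - θ₂ t x) t x +
    ⟪u t x, gradient (fun y => θ₁ t y - θ₂ t y) x⟫_ℝ = κ * laplacian (fun y => θ₁ t y - θ₂ t y) x
  rw [hdt, hgrad, hlap]
  linear_combination e1 - e2

omit [DecidableEq d] in
/-- A jointly smooth velocity field on `[0, T] × T^d` is essentially bounded on `(0,T) × ℝ^d`
(space–time lift). [folklore] -/
theorem memLp_top_stLift_of_isSmoothSpaceTimeOn {F : Type*} [NormedAddCommGroup F] [NormedSpace ℝ F]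
    {v : ℝ → UnitAddTorus d → F} (hv : IsSmoothSpaceTimeOn (Icc 0 T) v) :
    MemLp (stLift v) ∞ (volume.restrict (Ioo 0 T ×ˢ (univ : Set (EuclideanSpace ℝ d)))) := by
  obtain ⟨C, hC⟩ := hv.exists_norm_le_of_isCompact isCompact_Icc subset_rfl
  have hmeas := hv.aestronglyMeasurable_stLift measurableSet_Ioo Ioo_subset_Icc_self
  refine memLp_top_of_bound hmeas C ?_
  rw [ae_restrict_iff' (measurableSet_Ioo.prod MeasurableSet.univ)]
  exact ae_of_all _ fun z hz => hC z.1 (Ioo_subset_Icc_self hz.1) (proj z.2)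

/-- **Uniqueness of classical forced solutions on `[0, T]`.** Two classical solutions of
`∂ₜθ + u·∇θ = κΔθ + s` on `[0,T] × T^d` (`κ > 0`) with the same datum agree on `[0, T]`:
their difference `δ` is a classical solution of the homogeneous equation with datum `0`,
hence a weak solution (`IsClassicalScalarTransportOn.isWeakScalarTransportOn_holds`), so the
energy inequality (`IsWeakScalarTransportOn.lintegral_sq_add_le_holds`, DEIJ 2022, (1.3))
gives `‖δ(t)‖_{L²} = 0` for a.e. `t`, and continuity upgrades this to every `t ∈ [0, T]`
(Krylov 1996, Thm. 9.2.3, uniqueness clause; here by the elementary energy identity). [cite: Krylov1996, Thm. 9.2.3] -/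
theorem IsClassicalScalarTransportForcedOn.eq_on_Icc (hκ : 0 < κ) (hT : 0 < T)
    (h₁ : IsClassicalScalarTransportForcedOn (Icc 0 T) κ u s θ₁)
    (h₂ : IsClassicalScalarTransportForcedOn (Icc 0 T) κ u s θ₂) (h0 : θ₁ 0 = θ₂ 0) :
    ∀ t ∈ Icc 0 T, θ₁ t = θ₂ t := by
  set δ : ℝ → UnitAddTorus d → ℝ := fun t x => θ₁ t x - θ₂ t x with hδdef
  have hδ : IsClassicalScalarTransportOn (Icc 0 T) κ u δ := h₁.sub hT h₂
  have hδ0 : δ 0 = fun _ => 0 := by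
    funext x
    simp [hδdef, h0]
  -- the weak formulation and the energy inequality
  have hw : IsWeakScalarTransportOn T κ u (δ 0) δ :=
    IsClassicalScalarTransportOn.isWeakScalarTransportOn_holds hδ subset_rfl
  have hmem : MemLp (δ 0) 2 (volume : Measure (UnitAddTorus d)) := by
    rw [hδ0]; exact memLp_const 0
  have huinf := memLp_top_stLift_of_isSmoothSpaceTimeOn (T := T) h₁.smooth_velocity
  have hen := IsWeakScalarTransportOn.lintegral_sq_add_le_holds hκ hw hmem huinf
  have hrhs : (∫⁻ x, ‖δ 0 x‖ₑ ^ 2 : ℝ≥0∞) = 0 := by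
    rw [hδ0]; simp
  -- slices vanish for a.e. `t ∈ (0, T)`
  have hzero : ∀ᵐ t ∂(volume.restrict (Ioo 0 T)), ∀ x, δ t x = 0 := by
    filter_upwards [hen, ae_restrict_mem measurableSet_Ioo] with t ht htI
    rw [hrhs] at ht
    have hI : (∫⁻ x, ‖δ t x‖ₑ ^ 2 : ℝ≥0∞) = 0 := le_antisymm (le_self_add.trans ht) bot_le
    have hcont : Continuous (δ t) := (hδ.smooth_scalar.isSmooth_slice (Ioo_subset_Icc_self htI)).continuous
    have hmeas : AEMeasurable (fun x => ‖δ t x‖ₑ ^ 2) volume :=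
      (hcont.enorm.aemeasurable).pow_const 2
    have hae := (lintegral_eq_zero_iff' hmeas).1 hI
    have hae' : δ t =ᵐ[volume] (fun _ => 0) := by
      filter_upwards [hae] with x hx
      have hx' : ‖δ t x‖ₑ = 0 := by simpa using hx
      exact enorm_eq_zero.1 hx'
    have heq := (hcont.ae_eq_iff_eq volume continuous_const).1 hae'
    exact fun x => congrFun heq x
  -- continuity in time upgrades to every `t ∈ [0, T]`
  intro t ht
  funext x
  have hx0 : δ t x = 0 := by
    rcases eq_or_lt_of_le ht.1 with h0t | h0t
    · rw [← h0t]; exact congrFun hδ0 x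
    · have hcont : ContinuousOn (fun τ => δ τ x) (Ioc 0 T) := fun τ hτ =>
        ((hδ.smooth_scalar.hasDerivWithinAt_slice ⟨hτ.1.le, hτ.2⟩ x).continuousWithinAt).mono
          Ioc_subset_Icc_self
      exact Literature.Analysis.FluidPDE.eq_zero_of_continuousOn_Ioc_of_ae_eq_zero hcont
        (hzero.mono fun τ hτ => hτ x) ⟨h0t, ht.2⟩
  exact sub_eq_zero.1 hx0

end Uniqueness

/-! ### The named fact -/

/-- **Discharge of `Torus.exists_unique_isClassicalScalarTransportForcedOn`** (classical
well-posedness of the forced advection–diffusion equation with smooth drift on `T^d`; Krylov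
1996, Thm. 9.2.3 — the Cauchy problem `uₜ = Lu + f`, `u(0) = g` in `C^{1+δ/2,2+δ}`, here in its
smooth periodic form as used by Cheskidov 2023, §4 (4.2)): existence by the Fourier-side Picard
construction `Torus.exists_isClassicalScalarTransportForcedOn`, uniqueness on `[0, T]` by the
energy inequality `Torus.IsClassicalScalarTransportForcedOn.eq_on_Icc`. [cite: Krylov1996, Thm. 9.2.3] -/
theorem exists_unique_isClassicalScalarTransportForcedOn_holds :
    exists_unique_isClassicalScalarTransportForcedOn (d := d) := by
  intro κ T hκ hT u s θ₀ hu hdiv hs hθ₀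
  obtain ⟨θ, hθ, h0⟩ := exists_isClassicalScalarTransportForcedOn hκ hT hu hdiv hs hθ₀
  refine ⟨θ, hθ, h0, fun θ' hθ' h0' t ht => ?_⟩
  exact IsClassicalScalarTransportForcedOn.eq_on_Icc hκ hT hθ' hθ (h0'.trans h0.symm) t ht

end Torus

end Literature.Analysis.FluidPDE

end
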